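import Mathlib
import HarnessLib
import Summits.ResolutionOfSingularities.ResolutionOfSingularities.Theses.WildQuotients
import Summits.ResolutionOfSingularities.ResolutionOfSingularities.Theorems.WildQuotientsWildQuotientResolutionStubLocalDrop
import Summits.ResolutionOfSingularities.ResolutionOfSingularities.Theorems.WildQuotientsWildQuotientResolutionStubHasNormalSylowIff
import Summits.ResolutionOfSingularities.ResolutionOfSingularities.Theorems.WildQuotientsWildQuotientResolutionStubInertiaLe
import Literature.AlgebraicGeometry.Ramification.InertiaNormalSylow
import Literature.AlgebraicGeometry.Resolution.ResolutionOfSingularities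
import Literature.AlgebraicGeometry.Resolution.AlterationsProofs

/-!
# Phase 0 of line `Sketch` needs a FAITHFUL action (crux stmt-ResolutionOfSingularities-15640, `WildQuotients.WildQuotientResolution`)

Support for the skeleton `Cruxes/WildQuotientResolution/Lines/Sketch.lean` of the crux
`WildQuotientResolution`. The stub `stub_phaseZero` (Phase 0, "Sylow separation": a
`G`-equivariant proper birational REGULAR model `X♯ → X′` on which every inertia group has a
normal Sylow `p`-subgroup) was registered up to skeleton v3 (sha e658dfc5, leads c0/c1) WITHOUT
the hypothesis that `ρ : G →* Aut X′` is faithful — although the composition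
`WildQuotientResolution_of` reduces to a faithful action first (`Negative.wqFaithful_iff`) and the
proved glue `GluedSplit.wildQuotientResolution_of_phaseZero_of_pClosedWQ` (p138408) does carry
`Function.Injective ρ`. This file certifies that the omission is fatal, which is why skeleton v4
(lead c2) adds `hfaith : Function.Injective ρ` to the stub:

* `not_hasNormalSylow_two_perm_fin_three` — `S₃` has no normal Sylow `2`-subgroup (the three
  transpositions would lie in the unique Sylow `2`-subgroup, whose product of two of them has
  order `3`).
* `not_phaseZero_unfaithful` — **the unfaithful Phase-0 statement is false**: for the TRIVIAL
  action of `S₃` on `X′ = X₁ = Spec 𝔽₂` (`q = 𝟙`, all hypotheses of the stub hold) every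
  equivariant proper birational integral model `π : X♯ → Spec 𝔽₂` is an isomorphism (birational
  onto a point), so `ρ♯ g ≫ π = π` forces `ρ♯ g = 𝟙`, every inertia group of `ρ♯` is all of `S₃`,
  and `S₃` is not `2`-closed.
* `not_stub_phaseZero_v3` — the same for the LITERAL registered v3 signature (its three engine
  hypotheses are the landed theorems `LocalDrop.stub_localDrop`, `NormalSylow.stub_hasNormalSylow_iff`,
  `InertiaLe.stub_inertia_le`, so they do not rescue it).

With faithfulness the zero-dimensional witness disappears (a faithful action on `Spec L` has
trivial inertia), and in dimension one all inertia groups of a faithful action are `p`-closed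
(`PhaseZeroDimOne`); the repaired stub is the honest open-adjacent Phase 0 of the line card.
-/

-- single-problem summit: the doubled namespace component `ResolutionOfSingularities` is forced
set_option linter.dupNamespace false

noncomputable section

open CategoryTheory AlgebraicGeometry TopologicalSpace
open Literature.AlgebraicGeometry.Resolution Literature.AlgebraicGeometry.Ramification

namespace Summit.ResolutionOfSingularities.ResolutionOfSingularities.Theorems.WildQuotientResolution.PhaseZeroFaithful

/-- **`S₃` has no normal Sylow `2`-subgroup.** If it had one, the Sylow `2`-subgroup would be
unique and would contain the cyclic `2`-groups generated by the transpositions `(0 1)` and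
`(1 2)`, hence their product, a `3`-cycle — impossible in a `2`-group. [folklore] -/
theorem not_hasNormalSylow_two_perm_fin_three : ¬ HasNormalSylow 2 (Equiv.Perm (Fin 3)) := by
  haveI : Fact (Nat.Prime 2) := ⟨Nat.prime_two⟩
  haveI : Fact (Nat.Prime 3) := ⟨Nat.prime_three⟩
  intro h
  haveI := h.subsingleton
  -- the two transpositions and the cyclic 2-groups they generate
  have hz : ∀ τ : Equiv.Perm (Fin 3), τ ^ 2 = 1 → τ ≠ 1 →
      IsPGroup 2 (Subgroup.zpowers τ) := fun τ h2 h1 =>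
    IsPGroup.of_card (n := 1) (by rw [Nat.card_zpowers, orderOf_eq_prime h2 h1, pow_one])
  obtain ⟨P₁, hP₁⟩ :=
    (hz (Equiv.swap 0 1) (by decide) (by decide)).exists_le_sylow
  obtain ⟨P₂, hP₂⟩ :=
    (hz (Equiv.swap 1 2) (by decide) (by decide)).exists_le_sylow
  have hP : P₁ = P₂ := Subsingleton.elim _ _
  subst hP
  have h₁ : Equiv.swap (0 : Fin 3) 1 ∈ (P₁ : Subgroup (Equiv.Perm (Fin 3))) :=
    hP₁ (Subgroup.mem_zpowers _)
  have h₂ : Equiv.swap (1 : Fin 3) 2 ∈ (P₁ : Subgroup (Equiv.Perm (Fin 3))) :=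
    hP₂ (Subgroup.mem_zpowers _)
  -- their product is a 3-cycle inside the 2-group `P₁`
  obtain ⟨n, hn⟩ := P₁.isPGroup' ⟨_, mul_mem h₁ h₂⟩
  have hn' : (Equiv.swap (0 : Fin 3) 1 * Equiv.swap 1 2) ^ 2 ^ n = 1 := by
    have := congrArg Subtype.val hn
    simpa using this
  have hord : orderOf (Equiv.swap (0 : Fin 3) 1 * Equiv.swap 1 2) = 3 :=
    orderOf_eq_prime (by decide) (by decide)
  have hdvd : 3 ∣ 2 ^ n := hord ▸ orderOf_dvd_of_pow_eq_one hn'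
  exact absurd (Nat.prime_three.dvd_of_dvd_pow hdvd) (by decide)

/-- **The unfaithful Phase-0 statement is false.** The body of the v3 stub `stub_phaseZero`
(engine hypotheses dropped; no faithfulness of `ρ`) fails for the trivial action of `S₃` on
`Spec 𝔽₂` over itself at `p = 2`: a proper birational `π : X♯ → Spec 𝔽₂` with `X♯` integral is
an isomorphism (the dense open of birationality is the whole point), equivariance
`ρ♯ g ≫ π = π ≫ 𝟙` then gives `ρ♯ g = 𝟙`, so the inertia group at any point of `X♯` is the whole
of `S₃`, which has no normal Sylow `2`-subgroup. [folklore] -/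
theorem not_phaseZero_unfaithful :
    ¬ (∀ (p : ℕ) (_ : p.Prime) (k : Type) [Field k] [CharP k p] (X' X₁ : Scheme.{0})
        (f : X₁ ⟶ Spec (.of k)) (q : X' ⟶ X₁) (G : Type) [Group G] [Finite G]
        (ρ : G →* Aut X') [IsSeparated f] [LocallyOfFiniteType f] [QuasiCompact f]
        [IsIntegral X'], Scheme.IsRegular X' → ∀ [IsFinite q], (∀ g : G, (ρ g).hom ≫ q = q) →
        ∃ (Xs : Scheme.{0}) (π : Xs ⟶ X') (ρs : G →* Aut Xs), IsProper π ∧ IsBirational π ∧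
          IsIntegral Xs ∧ Scheme.IsRegular Xs ∧ (∀ g : G, (ρs g).hom ≫ π = π ≫ (ρ g).hom) ∧
          (∀ x : Xs, HasNormalSylow p (inertiaSubgroup ρs x)) ∧
          ∀ x : Xs, ∃ U : Xs.Opens, IsAffineOpen U ∧ x ∈ U ∧
            ∀ g : G, (ρs g).hom ⁻¹ᵁ U = U) := by
  intro h
  haveI : Fact (Nat.Prime 2) := ⟨Nat.prime_two⟩
  let S : Scheme.{0} := Spec (.of (ZMod 2))
  have hreg : Scheme.IsRegular S :=
    Scheme.IsRegular.of_topologicalKrullDim_le_zero (topologicalKrullDim_zero_of_discreteTopology _)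
  have hρ : ∀ g : Equiv.Perm (Fin 3), ((1 : Equiv.Perm (Fin 3) →* Aut S) g).hom ≫ 𝟙 S = 𝟙 S :=
    fun g => by simp
  obtain ⟨Xs, π, ρs, -, ⟨U, hUd, -, hUiso⟩, hXs, -, hequiv, hNpS, -⟩ :=
    h 2 Nat.prime_two (ZMod 2) S S (𝟙 S) (𝟙 S) (Equiv.Perm (Fin 3)) 1 hreg hρ
  -- the dense open of birationality is everything: `π` is an isomorphism
  have hU : U = ⊤ := by
    obtain ⟨u, hu⟩ := hUd.nonempty
    apply TopologicalSpace.Opens.ext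
    rw [TopologicalSpace.Opens.coe_top]
    exact Set.eq_univ_of_forall fun x => (Subsingleton.elim u x) ▸ hu
  subst hU
  haveI := hUiso
  haveI : IsIso π := (MorphismProperty.isomorphisms.iff π).mp
    (IsZariskiLocalAtTarget.of_iSup_eq_top (P := MorphismProperty.isomorphisms Scheme.{0})
      (fun _ : Unit => (⊤ : S.Opens)) (by simp)
      fun _ => (MorphismProperty.isomorphisms.iff _).mpr ‹_›)
  -- hence the lifted action is trivial …
  have htriv : ∀ g : Equiv.Perm (Fin 3), (ρs g).hom = 𝟙 Xs := fun g => by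
    have hg := hequiv g
    simp only [MonoidHom.one_apply, aut_one_hom, Category.comp_id] at hg
    exact (cancel_mono π).mp (by rw [hg, Category.id_comp])
  -- … and every inertia group is the whole of `S₃`
  obtain ⟨x⟩ : Nonempty Xs := inferInstance
  have htop : inertiaSubgroup ρs x = ⊤ :=
    eq_top_iff.mpr fun g _ => by rw [mem_inertiaSubgroup_iff, htriv, Category.comp_id]
  have h2 : HasNormalSylow 2 (⊤ : Subgroup (Equiv.Perm (Fin 3))) := htop ▸ hNpS x
  exact not_hasNormalSylow_two_perm_fin_three
    (h2.of_surjective (Subgroup.subtype ⊤) fun g => ⟨⟨g, Subgroup.mem_top g⟩, rfl⟩)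

/-- **The registered v3 signature of `stub_phaseZero` is false as stated.** Its three engine
hypotheses are theorems of the tree (`LocalDrop.stub_localDrop` p130134,
`NormalSylow.stub_hasNormalSylow_iff` p130224, `InertiaLe.stub_inertia_le` p130271), so the
statement reduces to `not_phaseZero_unfaithful`. Skeleton v4 repairs the stub by adding
`Function.Injective ρ` (available in the composition after `Negative.wqFaithful_iff`).
[folklore] -/
theorem not_stub_phaseZero_v3 :
    ¬ (∀ (_ : ∀ (p : ℕ) [Fact p.Prime] (κ W I : Type) [Field κ] [CharP κ p] [AddCommGroup W]
          [Module κ W] [Group I] [Finite I] (τ : I →* (W →ₗ[κ] W)),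
          (∀ v : W, (∀ g ∈ Subgroup.closure {g : I | ∃ n : ℕ, g ^ p ^ n = 1}, τ g v = v) →
            v = 0) →
          ∀ w : W, w ≠ 0 →
            Subgroup.closure {g : I | (∃ n : ℕ, g ^ p ^ n = 1) ∧ ∃ c : κ, τ g w = c • w} <
              Subgroup.closure {g : I | ∃ n : ℕ, g ^ p ^ n = 1})
        (_ : ∀ (p : ℕ) [Fact p.Prime] (I : Type) [Group I] [Finite I],
          HasNormalSylow p I ↔ IsPGroup p (Subgroup.closure {g : I | ∃ n : ℕ, g ^ p ^ n = 1}))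
        (_ : ∀ (G : Type) [Group G] (X Y : Scheme.{0}) (σ : G →* Aut X) (τ : G →* Aut Y)
          (π : X ⟶ Y), (∀ g : G, (σ g).hom ≫ π = π ≫ (τ g).hom) → ∀ x : X,
            inertiaSubgroup σ x ≤ inertiaSubgroup τ (π.base x))
        (p : ℕ) (_ : p.Prime) (k : Type) [Field k] [CharP k p] (X' X₁ : Scheme.{0})
        (f : X₁ ⟶ Spec (.of k)) (q : X' ⟶ X₁) (G : Type) [Group G] [Finite G]
        (ρ : G →* Aut X') [IsSeparated f] [LocallyOfFiniteType f] [QuasiCompact f]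
        [IsIntegral X'], Scheme.IsRegular X' → ∀ [IsFinite q], (∀ g : G, (ρ g).hom ≫ q = q) →
        ∃ (Xs : Scheme.{0}) (π : Xs ⟶ X') (ρs : G →* Aut Xs), IsProper π ∧ IsBirational π ∧
          IsIntegral Xs ∧ Scheme.IsRegular Xs ∧ (∀ g : G, (ρs g).hom ≫ π = π ≫ (ρ g).hom) ∧
          (∀ x : Xs, HasNormalSylow p (inertiaSubgroup ρs x)) ∧
          ∀ x : Xs, ∃ U : Xs.Opens, IsAffineOpen U ∧ x ∈ U ∧
            ∀ g : G, (ρs g).hom ⁻¹ᵁ U = U) := fun h =>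
  not_phaseZero_unfaithful fun p hp k _ _ X' X₁ f q G _ _ ρ _ _ _ _ hreg _ hρ =>
    h (fun p _ _ _ _ _ _ _ _ _ _ τ hfix _ hw => LocalDrop.stub_localDrop p τ hfix hw)
      (fun p _ _ _ _ => NormalSylow.stub_hasNormalSylow_iff p)
      (fun _ _ _ _ σ τ π hπ x => InertiaLe.stub_inertia_le σ τ π hπ x)
      p hp k X' X₁ f q G ρ hreg hρ

end Summit.ResolutionOfSingularities.ResolutionOfSingularities.Theorems.WildQuotientResolution.PhaseZeroFaithful

end
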